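import Summits.ResolutionOfSingularities.ResolutionOfSingularities.Theorems.EquisingularLiftEquisingularLiftNatCarrierDeltaComapFrame
import Literature.AlgebraicGeometry.Resolution.RegularLocalRingsQuotient
import HarnessLib

/-!
# [OURS · L1 W4.5(b)] T-CARRIER-Δ — the model square at the special point: residue model, regular special stalk, `𝓘(s)·𝒪_{F₁} = 𝔪_x`

Support file of the crux chain w45b (cell `res-hironaka`, slot W4.5(b)), working crux **EL♮** (stmt-ResolutionOfSingularities-20038),
registered stub `stub_elnat_tcDeltaPointResolution`; glue for res-type-100's HΔTC₃ assembly (the supplier of res-D-pv-029's T-INST₂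
`stub_elnat_tcDeltaPointResolution_of_carrierLift_dim`, p521291). In a MODEL SQUARE `IsPullback j t r' (Spec θ)` over a DVR `O ↠ k`
(res-D-pv-029's …NatCarrierDeltaComapFrame: `j^♯_x` onto, kills `𝔪_O`, kernel `⊆ (ϖ)`), with res-type-100's SECTION FRAME at `j x`
(`(c) = 𝓘(s)_{j x}`, `(c) + (ϖ) = 𝔪_{j x}`, `ϖ ∉ (c)`, `θ_R : 𝒪/(c) ≅ O` the identity on constants):
* `span_stalkMap_eq_maximalIdeal_of_model` — the images `c̄ = j^♯ c` generate `𝔪_x ⊆ 𝒪_{F₁,x}`;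
* `isRegularLocalRing_stalk_of_model` — `𝒪_{F₁,x} ≅ 𝒪_{X',j x}/(ϖ)` is regular (`ϖ ∉ 𝔪²` by Nakayama; Matsumura 14.2);
* `comap_ker_eq_vanishingIdeal_of_model` — `𝓘(s) · 𝒪_{F₁} = 𝓘_{{x}}` (the hypothesis `hJ` of res-D-pv-029's (v), p517803);
* `residueModel_surjective_and_ker` — the residue model `π₀ = (mod c̄) ∘ j^♯_x ∘ ι : O → 𝒪_{F₁,x}/(c̄)` is onto with kernel `𝔪_O`
  (so `𝒪_{F₁,x}/(c̄) ≅ κ_O`, the field res-type-032's T-ΔLIFT is run over);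
* two one-line algebra adapters (`forall_ideal_quotient_span_singleton_congr`, `ringHom_eval_eq_eval_map`).
OURS; NOT a statement of any manuscript; AI-written. Filed `--supports stmt-ResolutionOfSingularities-20038 --as helper`.
-/

set_option linter.dupNamespace false -- mandated namespace `Summit.<Summit>.<Problem>` of this single-conjunct summit

noncomputable section

open CategoryTheory CategoryTheory.Limits AlgebraicGeometry TopologicalSpace IsLocalRing
open Literature.AlgebraicGeometry.Resolution
open AlgebraicGeometry.Scheme.IdealSheafData

namespace Summit.ResolutionOfSingularities.ResolutionOfSingularities.Cruxes.EquisingularLiftNat.Sections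

/-! ## Two algebra adapters -/

/-- Transport of a «primes of `A/(f)` through `a` have regular localisations» clause along `f = g`. [folklore] -/
theorem forall_ideal_quotient_span_singleton_congr {A : Type*} [CommRing A] {f g : A} (hfg : f = g) (a : A)
    (H : ∀ (Q : Ideal (A ⧸ Ideal.span {g})) [Q.IsPrime],
      Ideal.Quotient.mk (Ideal.span {g}) a ∈ Q → IsRegularLocalRing (Localization.AtPrime Q)) :
    ∀ (Q : Ideal (A ⧸ Ideal.span {f})) [Q.IsPrime],
      Ideal.Quotient.mk (Ideal.span {f}) a ∈ Q → IsRegularLocalRing (Localization.AtPrime Q) := by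
  subst hfg
  exact H

/-- `f (Φ(c)) = (f_* Φ)(f ∘ c)`. [folklore] -/
theorem ringHom_eval_eq_eval_map {R S : Type*} [CommRing R] [CommRing S] (f : R →+* S) {σ : Type*} (c : σ → R)
    (Φ : MvPolynomial σ R) :
    f (MvPolynomial.eval c Φ) = MvPolynomial.eval (fun i => f (c i)) (MvPolynomial.map f Φ) := by
  rw [MvPolynomial.eval_map, show MvPolynomial.eval c Φ = MvPolynomial.eval₂ (RingHom.id _) c Φ from rfl,
    MvPolynomial.eval₂_comp_left, RingHom.comp_id]
  rfl

/-! ## The images of the frame generate `𝔪_x` -/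

/-- In a model square over a local ring, if `(c) + (ϖ) = 𝔪_{j x}` with `ϖ ∈ 𝔪_O` then the images `j^♯_x c` generate `𝔪_x`
(`j^♯_x` is a surjective local homomorphism killing `ϖ`). [folklore] -/
theorem span_stalkMap_eq_maximalIdeal_of_model {O k : Type} [CommRing O] [IsLocalRing O] [Field k] (θ : O →+* k)
    (hθ : Function.Surjective θ) {X' F₁ : Scheme.{0}} (r' : X' ⟶ Spec (.of O)) (j : F₁ ⟶ X') (t : F₁ ⟶ Spec (.of k))
    (hsq : IsPullback j t r' (Spec.map (CommRingCat.ofHom θ))) (x : F₁) (ϖ : O) (hϖ : ϖ ∈ maximalIdeal O)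
    {n : ℕ} (c : Fin n → X'.presheaf.stalk (j x))
    (h𝔪 : Ideal.span (Set.range c) ⊔
      Ideal.span {(X'.presheaf.Γgerm (j x)).hom (r'.appTop.hom ((Scheme.ΓSpecIso (.of O)).inv.hom ϖ))} =
        maximalIdeal (X'.presheaf.stalk (j x))) :
    Ideal.span (Set.range fun i => (j.stalkMap x).hom (c i)) = maximalIdeal (F₁.presheaf.stalk x) := by
  have hsurj := stalkMap_model_surjective θ hθ r' j t hsq x
  have hrange : Set.range (fun i => (j.stalkMap x).hom (c i)) = (j.stalkMap x).hom '' Set.range c := Set.range_comp _ _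
  have hmap : Ideal.map (j.stalkMap x).hom (maximalIdeal (X'.presheaf.stalk (j x))) = maximalIdeal (F₁.presheaf.stalk x) := by
    rcases Ideal.map_eq_top_or_isMaximal_of_surjective (j.stalkMap x).hom hsurj
      (maximalIdeal.isMaximal (X'.presheaf.stalk (j x))) with h | h
    · exfalso
      have hle : Ideal.map (j.stalkMap x).hom (maximalIdeal (X'.presheaf.stalk (j x))) ≤ maximalIdeal (F₁.presheaf.stalk x) :=
        Ideal.map_le_iff_le_comap.mpr fun a ha => Ideal.mem_comap.mpr (map_nonunit (j.stalkMap x).hom a ha)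
      rw [h] at hle
      exact (maximalIdeal.isMaximal (F₁.presheaf.stalk x)).ne_top (top_le_iff.mp hle)
    · exact IsLocalRing.eq_maximalIdeal h
  rw [hrange, ← Ideal.map_span, ← hmap, ← h𝔪, Ideal.map_sup, Ideal.map_span _ {_}, Set.image_singleton,
    stalkMap_model_varpi θ hθ r' j t hsq x ϖ hϖ, Ideal.span_singleton_eq_bot.mpr rfl, sup_bot_eq]

/-! ## The special stalk is regular -/

/-- **`𝒪_{F₁,x}` is regular.** In a model square over a DVR with uniformizer `ϖ`: if `𝒪_{X',j x}` is regular and `(c) + (ϖ) = 𝔪_{j x}`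
with `ϖ ∉ (c)`, then `ϖ ∉ 𝔪²` (Nakayama), so `𝒪_{X',j x}/(ϖ)` is regular (Matsumura 14.2), and `𝒪_{F₁,x} ≅ 𝒪_{X',j x}/(ϖ)`
(`j^♯_x` is onto with kernel `(ϖ)`). [cite: Matsumura1987, Thm. 14.2] -/
theorem isRegularLocalRing_stalk_of_model (O : Type) [CommRing O] [IsDomain O] [IsDiscreteValuationRing O] (k : Type) [Field k]
    (θ : O →+* k) (hθ : Function.Surjective θ) {X' F₁ : Scheme.{0}} (r' : X' ⟶ Spec (.of O))
    (j : F₁ ⟶ X') (t : F₁ ⟶ Spec (.of k)) (hsq : IsPullback j t r' (Spec.map (CommRingCat.ofHom θ))) (x : F₁)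
    (hreg : IsRegularLocalRing (X'.presheaf.stalk (j x))) (ϖ : O) (hϖ : Irreducible ϖ)
    {n : ℕ} (c : Fin n → X'.presheaf.stalk (j x))
    (h𝔪 : Ideal.span (Set.range c) ⊔
      Ideal.span {(X'.presheaf.Γgerm (j x)).hom (r'.appTop.hom ((Scheme.ΓSpecIso (.of O)).inv.hom ϖ))} =
        maximalIdeal (X'.presheaf.stalk (j x)))
    (hϖc : (X'.presheaf.Γgerm (j x)).hom (r'.appTop.hom ((Scheme.ΓSpecIso (.of O)).inv.hom ϖ)) ∉ Ideal.span (Set.range c)) :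
    IsRegularLocalRing (F₁.presheaf.stalk x) := by
  haveI := hreg
  have hϖO : ϖ ∈ maximalIdeal O := by rw [hϖ.maximalIdeal_eq]; exact Ideal.mem_span_singleton_self ϖ
  have hϖ𝔪 : (X'.presheaf.Γgerm (j x)).hom (r'.appTop.hom ((Scheme.ΓSpecIso (.of O)).inv.hom ϖ)) ∈
      maximalIdeal (X'.presheaf.stalk (j x)) := by
    rw [← h𝔪]; exact Ideal.mem_sup_right (Ideal.mem_span_singleton_self _)
  have hϖ2 : (X'.presheaf.Γgerm (j x)).hom (r'.appTop.hom ((Scheme.ΓSpecIso (.of O)).inv.hom ϖ)) ∉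
      maximalIdeal (X'.presheaf.stalk (j x)) ^ 2 := by
    intro h2
    apply hϖc
    have hle : maximalIdeal (X'.presheaf.stalk (j x)) ≤
        Ideal.span (Set.range c) ⊔ maximalIdeal (X'.presheaf.stalk (j x)) • maximalIdeal (X'.presheaf.stalk (j x)) := by
      conv_lhs => rw [← h𝔪]
      refine sup_le le_sup_left ((Ideal.span_singleton_le_iff_mem _).mpr (Ideal.mem_sup_right ?_))
      rw [Ideal.smul_eq_mul, ← pow_two]
      exact h2
    exact Submodule.le_of_le_smul_of_le_jacobson_bot (IsNoetherian.noetherian _) (IsLocalRing.maximalIdeal_le_jacobson _)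
      hle hϖ𝔪
  have hker : RingHom.ker (j.stalkMap x).hom =
      Ideal.span {(X'.presheaf.Γgerm (j x)).hom (r'.appTop.hom ((Scheme.ΓSpecIso (.of O)).inv.hom ϖ))} :=
    le_antisymm (ker_stalkMap_model_le O k θ hθ r' j t hsq x ϖ hϖ)
      ((Ideal.span_singleton_le_iff_mem _).mpr (by
        rw [RingHom.mem_ker]; exact stalkMap_model_varpi θ hθ r' j t hsq x ϖ hϖO))
  haveI := (IsRegularLocalRing.quotient_span_singleton hϖ𝔪 hϖ2).1
  exact IsRegularLocalRing.of_ringEquiv ((Ideal.quotEquivOfEq hker.symm).trans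
    (RingHom.quotientKerEquivOfSurjective (stalkMap_model_surjective θ hθ r' j t hsq x)))

/-! ## `𝓘(s) · 𝒪_{F₁} = 𝓘_{{x}}` -/

/-- **The section meets the special fibre in the reduced point `x`.** In a model square over a local ring `O ↠ k` with a section
`s` of the separated `r'` through `s(s₀) = j x` (`x` closed): if the images of generators `c` of `𝓘(s)_{j x}` generate `𝔪_x`,
then `𝓘(s) · 𝒪_{F₁} = 𝓘_{{x}}` — stalkwise: `𝔪_x` at `x`, and the unit ideal off `x` (`range s ∩ range j = {j x}`, `j` injective).
[folklore] -/
theorem comap_ker_eq_vanishingIdeal_of_model {O k : Type} [CommRing O] [IsLocalRing O] [Field k] (θ : O →+* k)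
    (hθ : Function.Surjective θ) {X' F₁ : Scheme.{0}} (r' : X' ⟶ Spec (.of O)) [IsSeparated r']
    (s : Spec (.of O) ⟶ X') (hs : s ≫ r' = 𝟙 _) (j : F₁ ⟶ X') (t : F₁ ⟶ Spec (.of k))
    (hsq : IsPullback j t r' (Spec.map (CommRingCat.ofHom θ))) (x : F₁) (hx : IsClosed ({x} : Set F₁))
    (hss : s (IsLocalRing.closedPoint O) = j x)
    {n : ℕ} (c : Fin n → X'.presheaf.stalk (j x)) (hcI : Ideal.span (Set.range c) = stalkIdeal s.ker (j x))
    (hc𝔪 : Ideal.span (Set.range fun i => (j.stalkMap x).hom (c i)) = maximalIdeal (F₁.presheaf.stalk x)) :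
    s.ker.comap j = vanishingIdeal ⟨{x}, hx⟩ := by
  haveI : IsClosedImmersion (Spec.map (CommRingCat.ofHom θ)) := IsClosedImmersion.spec_of_surjective _ hθ
  haveI : IsClosedImmersion j := MorphismProperty.IsStableUnderBaseChange.of_isPullback hsq.flip inferInstance
  haveI : IsClosedImmersion (s ≫ r') := by rw [hs]; infer_instance
  haveI : IsClosedImmersion s := IsClosedImmersion.of_comp s r'
  refine ext_of_forall_stalkIdeal_eq fun y => ?_
  by_cases hy : y = x
  · subst hy
    rw [stalkIdeal_comap_eq_map_stalkMap, ← hcI, Ideal.map_span, ← Set.range_comp, stalkIdeal_vanishingIdeal_singleton hx]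
    exact hc𝔪
  · have hrj : r' (j y) = IsLocalRing.closedPoint O := by
      have h : j y ∈ Set.range j := ⟨y, rfl⟩
      rw [range_eq_preimage_of_isPullback hsq, range_specMap_of_surjective_of_field θ hθ] at h
      exact h
    have h1 : y ∉ (s.ker.comap j).support := by
      intro h
      have h' : j y ∈ (s.ker.support : Set X') := by
        have h'' : y ∈ ((s.ker.comap j).support : Set F₁) := h
        rw [Scheme.IdealSheafData.support_comap] at h''
        exact h''
      rw [Scheme.Hom.support_ker, s.isClosedEmbedding.isClosed_range.closure_eq] at h'
      obtain ⟨z, hz⟩ := h'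
      have hz' : z = IsLocalRing.closedPoint O := by
        have e : (s ≫ r') z = z := by rw [hs]; rfl
        rw [Scheme.Hom.comp_apply, hz, hrj] at e
        exact e.symm
      apply hy
      apply j.isClosedEmbedding.injective
      rw [← hz, hz', hss]
    have h2 : y ∉ (vanishingIdeal (⟨{x}, hx⟩ : Closeds F₁)).support := by
      intro h
      have h'' : y ∈ ((vanishingIdeal (⟨{x}, hx⟩ : Closeds F₁)).support : Set F₁) := h
      rw [Scheme.IdealSheafData.coe_support_vanishingIdeal] at h''
      exact hy h''
    rw [stalkIdeal_eq_top_of_not_mem_support h1, stalkIdeal_eq_top_of_not_mem_support h2]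

/-! ## The residue model `π₀ : O ↠ 𝒪_{F₁,x}/(c̄)` -/

/-- **The residue model.** In a model square, with res-type-100's frame `θ_R : 𝒪_{X',j x}/(c) ≅ O` (identity on constants) and
`(c̄) = 𝔪_x`: the composite `π₀ = (mod c̄) ∘ j^♯_x ∘ ι : O → 𝒪_{F₁,x}/(c̄)` is surjective with kernel `𝔪_O`. [folklore] -/
theorem residueModel_surjective_and_ker {O k : Type} [CommRing O] [IsLocalRing O] [Field k] (θ : O →+* k)
    (hθ : Function.Surjective θ) {X' F₁ : Scheme.{0}} (r' : X' ⟶ Spec (.of O)) (j : F₁ ⟶ X') (t : F₁ ⟶ Spec (.of k))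
    (hsq : IsPullback j t r' (Spec.map (CommRingCat.ofHom θ))) (x : F₁)
    {n : ℕ} (c : Fin n → X'.presheaf.stalk (j x))
    (θR : (X'.presheaf.stalk (j x) ⧸ Ideal.span (Set.range c)) ≃+* O)
    (hθR : ∀ b : O, θR (Ideal.Quotient.mk _ ((X'.presheaf.Γgerm (j x)).hom
      (r'.appTop.hom ((Scheme.ΓSpecIso (.of O)).inv.hom b)))) = b)
    (hc𝔪 : Ideal.span (Set.range fun i => (j.stalkMap x).hom (c i)) = maximalIdeal (F₁.presheaf.stalk x))
    {π₀ : O →+* F₁.presheaf.stalk x ⧸ Ideal.span (Set.range fun i => (j.stalkMap x).hom (c i))}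
    (hπ₀ : π₀ = ((Ideal.Quotient.mk (Ideal.span (Set.range fun i => (j.stalkMap x).hom (c i)))).comp
      (j.stalkMap x).hom).comp ((Scheme.ΓSpecIso (.of O)).inv ≫ r'.appTop ≫ X'.presheaf.Γgerm (j x)).hom) :
    Function.Surjective π₀ ∧ RingHom.ker π₀ = maximalIdeal O := by
  subst hπ₀
  have hmax : (Ideal.span (Set.range fun i => (j.stalkMap x).hom (c i))).IsMaximal := by
    rw [hc𝔪]; exact maximalIdeal.isMaximal _
  have hsurj : Function.Surjective (((Ideal.Quotient.mk (Ideal.span (Set.range fun i => (j.stalkMap x).hom (c i)))).comp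
      (j.stalkMap x).hom).comp ((Scheme.ΓSpecIso (.of O)).inv ≫ r'.appTop ≫ X'.presheaf.Γgerm (j x)).hom) := by
    intro z
    obtain ⟨y, rfl⟩ := Ideal.Quotient.mk_surjective z
    obtain ⟨w, rfl⟩ := stalkMap_model_surjective θ hθ r' j t hsq x y
    refine ⟨θR (Ideal.Quotient.mk _ w), ?_⟩
    have h1 : Ideal.Quotient.mk (Ideal.span (Set.range c)) ((X'.presheaf.Γgerm (j x)).hom (r'.appTop.hom
        ((Scheme.ΓSpecIso (.of O)).inv.hom (θR (Ideal.Quotient.mk _ w))))) = Ideal.Quotient.mk _ w :=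
      θR.injective (by rw [hθR])
    rw [Ideal.Quotient.eq] at h1
    simp only [RingHom.comp_apply, CommRingCat.hom_comp]
    rw [Ideal.Quotient.eq, ← map_sub]
    have h2 := Ideal.mem_map_of_mem (j.stalkMap x).hom h1
    rwa [Ideal.map_span, ← Set.range_comp] at h2
  refine ⟨hsurj, ?_⟩
  haveI : Nontrivial (F₁.presheaf.stalk x ⧸ Ideal.span (Set.range fun i => (j.stalkMap x).hom (c i))) :=
    Ideal.Quotient.nontrivial_iff.mpr hmax.ne_top
  symm
  refine (maximalIdeal.isMaximal O).eq_of_le (RingHom.ker_ne_top _) fun a ha => ?_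
  rw [RingHom.mem_ker]
  simp only [RingHom.comp_apply, CommRingCat.hom_comp]
  rw [stalkMap_model_varpi θ hθ r' j t hsq x a ha, map_zero]

end Summit.ResolutionOfSingularities.ResolutionOfSingularities.Cruxes.EquisingularLiftNat.Sections

end
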